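import Summits.QuantumFields.BalabanUV.Beta.EriceFlowEnclosureB12AsPrintedHistoryContagionProfile
import Literature.MathematicalPhysics.QuantumFieldTheory.Balaban1983to89.T4ContinuumCoupling

/-!
# Beta / EriceFlowEnclosureB12AsPrintedHistoryContagionShift — ASYMPTOTIC FREEDOM IS CONTAGIOUS, part 5: the contagion transports to node
# U2's SCALE-SHIFT coupling matching (depth K against depth K + 1, pinned at the renormalized coupling), so node U2's typed output
# `T4CauchySum.InjectedRate (2c∕(1−θ)) 0 θ` — and with it the CONTINUUM RUNNING COUPLING of `T4ContinuumCoupling` (convergence of the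
# effective couplings at every physical scale as the cutoff is removed, the limit flow, a geometric tail, logarithmic asymptotic freedom) —
# follows from ONE reference run per depth carrying (0.31)'s lower half, NE4 and coupling-chart fading memory, for EVERY renormalized coupling
# below ONE threshold: node U2's asymptotic-freedom LETTER (`BetaLowerH b` ∕ `EventualLowerH b k₀`, the located unprinted input T09.F) and its
# box admission `C(γ³ + 2γ∕b) ≤ (1 − θ)∕2` are BOTH unnecessary near zero renormalized coupling (β-flow team, prover 1 = recursion ∕ upper ∕
# bare-coupling ∕ uniqueness side, unit `b2b-balaban-beta-bflow-p1`, gen 36; ROW AP-I·Uc × NODE U2; parts 1–4 = gen 35 `…HistoryContagion` ∕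
# `…Profile` ∕ `…End` ∕ `…Sharp`; part 6 `…HistoryContagionShiftEnd` = the ENDs on the as-printed carrier from [I] THEOREM 2 AS TYPED)

HONEST FRAMING (page 1 of everything the β sub-cell writes): discharging `BetaPertH` makes Bałaban's UV stability UNCONDITIONAL — a
real constructive-QFT result; it is NOT the continuum limit and NOT the Clay problem.  HONEST DEPENDENCY (cell reorg 2026-08-19,
verbatim): «continuum YM on T⁴ ⇐ BetaPertH ∧ nine spine estimates (0/9 proved); BetaPertH ⇐ (D1) ∧ (D4) ∧ CAP+tail; G-an2-4 gates
asym, D1 and NE2/3/4.»  THIS MODULE DISCHARGES NOTHING: [folklore] finite-sum ∕ limit bookkeeping composing BY NAME part 2's contagion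
(`inv_sq_lower_of_reference`, `inv_sq_upper_of_reference`, `sum_weights_le_of_reference`, `threshold_exists`) with node U2's LANDED kernel
`T4CouplingMatching.disc_le_of_fadingMemory` (lineage `b2b-balaban-t4-ne4-p2`; its binder list otherwise VERBATIM) and node U2's continuum read-out
`T4ContinuumCoupling` (`tendsto_coupling`, `gstar_flow`, `tendsto_beta_diag`, `abs_invSq_sub_astar_le`, …; nothing of theirs restated or
modified).  EVERY letter is a HYPOTHESIS on the abstract history-dependent family `S.β` of a `B12BetaAsPrinted.Setting` ([I] = T. Bałaban, Commun.
Math. Phys. **109** (1987) [Balaban1987RG1], statement-exact typing): the printed recursion (0.20) run-wise (`FlowStep.RGEqH`) with the infrared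
pin `g_K = g` (Theorem 2's renormalization condition p. 259, here a hypothesis on the family); NE4 `T4CouplingMatching.ScaleShiftRate c θ γ` (NOT
PRINTED — [I] p. 264 «We will investigate other properties in a separate paper»; GAPS G-t4-U2-1); the coupling-chart moduli `HistLipschitz Λ γ` with
`FadingMemory C θ Λ` (NOT PRINTED — p. 298 says only that β_j «depends also on all preceding coupling constants»; GAPS G-t4-U2-2); ONE reference run
per depth carrying (0.31)'s LOWER HALF from its end (`1∕t_K² + β*(K − i) ≤ 1∕t_i²` — the shape `Step.Discrete031` which [I] Theorem 2 p. 259, STATED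
WITHOUT PROOF ([Balaban1989LargeFieldII] p. 355), asserts for its tuned run; part 6 takes it from `Theorem2Statement` AS TYPED).  Nothing of
Bałaban's β is asserted; no modulus, rate, sign or bound for it is claimed.

THE POINT.  Node U2 (`T4CouplingMatching.injectedRate_of_runs` → node U6 `T4CauchySum` → `T4ContinuumCoupling.continuumRunning_of_runs_eventual`)
compares the run with K steps and the run with K + 1 steps pinned at the same renormalized coupling g_IR: `disc_step` + the two-sided fixed point
give `|1∕(g^{(K)}_j)² − 1∕(g^{(K+1)}_{j+1})²| ≤ (2c∕(1 − θ))θ^j` PROVIDED the AF weight sum `Σ_{i≤K} (g^{(K)}_i)² g^{(K+1)}_{i+1} ≤ U` is K-uniform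
with `C·U ≤ (1 − θ)∕2`; node U2 reads U = γ³ + 2γ∕b off the AF LETTER `b ≤ β` on the whole box (T09.F, unprinted) — which also ties the box γ
to the modulus.  Part 2's contagion removes both: with ONE reference run per depth (rate β*, endpoint g* fixed) EVERY in-box run of that depth
ending at a small e carries `1∕(4e²) + (β*∕4)(K − j) ≤ 1∕g_j²`; the depth-(K + 1) profile read at the shifted indices j + 1 is the depth-K profile
(§1), so the shifted pair's weight sum is `≤ 8e³ + 16e∕β*` (`sum_weights_le_of_reference` with g′ = g^{(K+1)} ∘ succ) and node U2's smallness
becomes `C(8e³ + 16e∕β*) ≤ (1 − θ)∕2` — a condition on the RENORMALIZED COUPLING ALONE, met below part 2's `threshold_exists` e₀(C, θ, β*, g*, γ)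
together with the two contagion conditions (§2 `disc_le_of_reference`, §3 `injectedRate_of_reference` ∕ `injectedRate_threshold_of_reference`:
ONE e₀ for ALL pinned families and ALL depths).  §4 reads the continuum running coupling off node U2's `T4ContinuumCoupling` BY NAME and adds
what the contagion profiles give in the limit: `1∕(4g_IR²) + (β*∕4)·m ≤ astar g m` (and `≤ 7∕(4g_IR²) + (β′* + 3β*∕4)·m` if the reference
carries (0.31)'s upper half) — the continuum running coupling is LOGARITHMICALLY ASYMPTOTICALLY FREE, `gstar g m ≤ (1∕(4g_IR²) + (β*∕4)m)^{−1∕2}`,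
with NO asymptotic-freedom letter on β anywhere (the pointwise floor `b ≤ bstar g m` of `ContinuumRunning.lower` is NOT obtained and not
claimed: part 3's end-anchored defect is genuine, prover 2's #59e).

WHAT THIS FILE PROVES (0 sorry, 0 def):
§1 `shiftedProfile_of_profile` (the depth-(K+1) quarter profile at the indices j + 1), `sum_shiftedWeights_le_of_profiles`.
§2 **`disc_le_of_reference`** (node U2's `disc_le_of_fadingMemory` with `hU`∕`hsmall` read off two reference runs: no AF letter, no box admission).
§3 **`injectedRate_of_reference`** (family form, node U2's spine shape), **`injectedRate_threshold_of_reference`** (ONE e₀ for all pinned families).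
§4 `quarterProf_le_invSq`, **`quarterProf_le_astar`**, **`gstar_le_of_reference`** (log-AF of the continuum running coupling), `astar_le_of_reference_upper`
   (the upper half), `astar_eq_add_sum_bstar`, **`sum_bstar_lower_of_reference`** ∕ `sum_bstar_upper_of_reference_upper` (the continuum β-values are AF ON
   AVERAGE with an end defect — what replaces `ContinuumRunning.lower`), **`continuumCoupling_of_reference`** (the package: convergence at every physical scale, `gstar ∈ ]0, γ]`, `gstar 0 = g_IR`, limit
   flow, diagonal β-limits, geometric tail `(2c∕(1−θ))θ^n∕(1−θ)`, log-AF bound), **`continuumCoupling_threshold_of_reference`**.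
NOT CLAIMED: any letter for Bałaban's β; `ContinuumRunning.lower`; Theorem 2; `BetaPertH`; the continuum limit of the MEASURES; Clay.
-/

namespace Summit.QuantumFields.BalabanUV.Beta.EriceFlowEnclosureB12AsPrintedHistoryContagionShift

open Finset Filter Topology
open Literature.MathematicalPhysics.QuantumFieldTheory.Balaban1983to89
open Literature.MathematicalPhysics.QuantumFieldTheory.Balaban1983to89.B12BetaAsPrinted
open Literature.MathematicalPhysics.QuantumFieldTheory.Balaban1983to89.FlowStep (prefixOf Box mem_box RGEqH)
open Literature.MathematicalPhysics.QuantumFieldTheory.Balaban1983to89.T4CouplingMatching (HistLipschitz FadingMemory ScaleShiftRate prof sprof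
  sprof_pos sprof_sq prof_pos disc disc_nonneg disc_le_of_fadingMemory)
open Literature.MathematicalPhysics.QuantumFieldTheory.Balaban1983to89.T4CauchySum (InjectedRate)
open Literature.MathematicalPhysics.QuantumFieldTheory.Balaban1983to89.T4ContinuumCoupling (invSq astar gstar bstar tendsto_invSq
  tendsto_coupling gstar_pos gstar_le gstar_zero one_div_gstar_sq gstar_flow tendsto_beta_diag abs_invSq_sub_astar_le)
open Summit.QuantumFields.BalabanUV.Beta.EriceFlowEnclosureB12AsPrintedHistoryContagionProfile (inv_sq_lower_of_reference
  inv_sq_upper_of_reference sum_weights_le_of_reference threshold_exists)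

noncomputable section

variable {S : Setting}

/-! ## §1 The shifted profile and the shifted pair's weight sum -/

/-- The depth-(K + 1) quarter-rate profile `1∕(4e²) + (β*∕4)((K + 1) − j) ≤ 1∕g_j²` (j ≤ K + 1), read at the SHIFTED indices j + 1 (j ≤ K), is the
depth-K profile of the shifted sequence `j ↦ g_{j+1}`: `1∕(4e²) + (β*∕4)(K − j) ≤ 1∕g_{j+1}²`. [folklore] -/
theorem shiftedProfile_of_profile {bs e : ℝ} {K : ℕ} {g : ℕ → ℝ}
    (h : ∀ j, j ≤ K + 1 → 1 / (4 * e ^ 2) + bs / 4 * (((K + 1 : ℕ) : ℝ) - j) ≤ 1 / (g j) ^ 2) :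
    ∀ j, j ≤ K → 1 / (4 * e ^ 2) + bs / 4 * ((K : ℝ) - j) ≤ 1 / (g (j + 1)) ^ 2 := by
  intro j hj
  have h1 := h (j + 1) (by omega)
  have e1 : (((K + 1 : ℕ) : ℝ) - ((j + 1 : ℕ) : ℝ)) = (K : ℝ) - j := by push_cast; ring
  rwa [e1] at h1

/-- **THE SHIFTED PAIR's AF WEIGHT SUM.**  Run A of depth K and run B of depth K + 1, couplings > 0, pinned `A_K = B_{K+1} = e`, A carrying the depth-K
quarter-rate profile from e and B the depth-(K + 1) one: `Σ_{i≤K} A_i² B_{i+1} ≤ 8e³ + 16e∕β*` — part 2's `sum_weights_le_of_reference` applied to A and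
B ∘ succ (node U2's telescoped profile sum at base point 2e, rate β*∕4). [cite: Balaban1987RG1, Thm 2 (0.31) p.259] -/
theorem sum_shiftedWeights_le_of_profiles {bs : ℝ} {K : ℕ} {gA gB : ℕ → ℝ} (hbs : 0 < bs)
    (hposA : ∀ i, i ≤ K → 0 < gA i) (hposB : ∀ i, i ≤ K + 1 → 0 < gB i) (hpin : gA K = gB (K + 1))
    (hA : ∀ j, j ≤ K → 1 / (4 * (gA K) ^ 2) + bs / 4 * ((K : ℝ) - j) ≤ 1 / (gA j) ^ 2)
    (hB : ∀ j, j ≤ K + 1 → 1 / (4 * (gB (K + 1)) ^ 2) + bs / 4 * (((K + 1 : ℕ) : ℝ) - j) ≤ 1 / (gB j) ^ 2) :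
    ∑ i ∈ range (K + 1), (gA i) ^ 2 * gB (i + 1) ≤ 8 * (gA K) ^ 3 + 16 * gA K / bs := by
  have hB' := shiftedProfile_of_profile hB
  exact sum_weights_le_of_reference (g' := fun i => gB (i + 1)) hbs hposA (fun i hi => hposB (i + 1) (by omega)) hpin hA hB'

/-! ## §2 Node U2's coupling matching of the shifted pair, the AF letter replaced by two reference runs -/

/-- **NODE U2's COUPLING MATCHING WITHOUT THE AF LETTER.**  Data (hypotheses, never facts): NE4 `ScaleShiftRate c θ γ S.β` (c ≥ 0), coupling-chart moduli
`HistLipschitz Λ γ S.β` with `FadingMemory C θ Λ` (0 < θ < 1, C ≥ 0); two runs of (0.20) in ]0, γ] — A of depth K, B of depth K + 1 — pinned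
`A_K = B_{K+1}` (=: e); two REFERENCE runs of (0.20) in ]0, γ] — T of depth K, T′ of depth K + 1 — each carrying (0.31)'s lower half from its own end at
rate β* > 0 (endpoints t_K, t′_{K+1} arbitrary); and the renormalized coupling e below the threshold: `4Ce ≤ β*(1 − θ)`, `e²·Q(t_K) ≤ 3∕4`,
`e²·Q(t′_{K+1}) ≤ 3∕4` (Q(s) = Cγ∕(1 − θ)² + Cs∕(1 − θ) + (2C∕((1 − θ)β*))² + 1∕(4s²)), `C(8e³ + 16e∕β*) ≤ (1 − θ)∕2`.  CONCLUSION: for every j ≤ K,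
**`|1∕A_j² − 1∕B_{j+1}²| ≤ (2c∕(1 − θ))θ^j`** — node U2's `disc_le_of_fadingMemory` VERBATIM, its AF weight bound `hU` and smallness `hsmall` READ OFF the two
reference runs through part 2's contagion (§1): NO lower bound ∕ sign letter on β, NO condition tying the box γ to the modulus.
[cite: Balaban1987RG1, (0.20) p.256, Thm 2 (0.31) p.259, §5 p.298] -/
theorem disc_le_of_reference {γ θ C c bs : ℝ} {Λ : ℕ → ℕ → ℝ} {K : ℕ} {gA gB tA tB : ℕ → ℝ}
    (hθ0 : 0 < θ) (hθ1 : θ < 1) (hC : 0 ≤ C) (hc : 0 ≤ c) (hbs : 0 < bs)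
    (hS : ScaleShiftRate c θ γ S.β) (hL : HistLipschitz Λ γ S.β) (hΛ : FadingMemory C θ Λ)
    (hA : RGEqH K S.β gA) (hB : RGEqH (K + 1) S.β gB) (htA : RGEqH K S.β tA) (htB : RGEqH (K + 1) S.β tB)
    (hAbox : ∀ i, i ≤ K → 0 < gA i ∧ gA i ≤ γ) (hBbox : ∀ i, i ≤ K + 1 → 0 < gB i ∧ gB i ≤ γ)
    (htAbox : ∀ i, i ≤ K → 0 < tA i ∧ tA i ≤ γ) (htBbox : ∀ i, i ≤ K + 1 → 0 < tB i ∧ tB i ≤ γ)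
    (hpin : gA K = gB (K + 1))
    (h031A : ∀ i, i ≤ K → 1 / (tA K) ^ 2 + bs * ((K : ℝ) - i) ≤ 1 / (tA i) ^ 2)
    (h031B : ∀ i, i ≤ K + 1 → 1 / (tB (K + 1)) ^ 2 + bs * (((K + 1 : ℕ) : ℝ) - i) ≤ 1 / (tB i) ^ 2)
    (hs1 : 4 * C * gA K ≤ bs * (1 - θ))
    (hs2A : (gA K) ^ 2 * (C * γ / (1 - θ) ^ 2 + C / (1 - θ) * tA K + (2 * C / ((1 - θ) * bs)) ^ 2 + 1 / (4 * (tA K) ^ 2)) ≤ 3 / 4)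
    (hs2B : (gA K) ^ 2 * (C * γ / (1 - θ) ^ 2 + C / (1 - θ) * tB (K + 1) + (2 * C / ((1 - θ) * bs)) ^ 2 + 1 / (4 * (tB (K + 1)) ^ 2))
      ≤ 3 / 4)
    (hs3 : C * (8 * (gA K) ^ 3 + 16 * gA K / bs) ≤ (1 - θ) / 2) :
    ∀ j, j ≤ K → disc gA gB j ≤ 2 * c / (1 - θ) * θ ^ j := by
  have hpA := inv_sq_lower_of_reference hθ0.le hθ1 hC hbs hL hΛ hA htA hAbox htAbox h031A hs1 hs2A
  rw [hpin] at hs1 hs2B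
  have hpB := inv_sq_lower_of_reference hθ0.le hθ1 hC hbs hL hΛ hB htB hBbox htBbox h031B hs1 hs2B
  have hU := sum_shiftedWeights_le_of_profiles hbs (fun i hi => (hAbox i hi).1) (fun i hi => (hBbox i hi).1) hpin hpA hpB
  exact disc_le_of_fadingMemory hθ0 hθ1 hc hC hA hB hAbox hBbox hpin hS hL hΛ hU hs3

/-! ## §3 Node U2's spine output `InjectedRate` for a pinned family, from a pinned reference family -/

/-- **NODE U2 IN THE SPINE's SHAPE, THE AF LETTER REPLACED BY A REFERENCE FAMILY.**  A family of runs `K ↦ g K` of (0.20) (same `S.β`), all couplings in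
]0, γ], pinned `g K K = g_IR`; a REFERENCE family `K ↦ t K` of (0.20) in ]0, γ] pinned at ONE endpoint `t K K = g*` and carrying (0.31)'s lower half from
it at rate β* for every depth (what [I] Theorem 2 gives at the single renormalized coupling g*); NE4 `ScaleShiftRate c θ γ S.β`; the moduli with fading
memory (0 < θ < 1); and g_IR below the threshold (`4Cg_IR ≤ β*(1 − θ)`, `g_IR²·Q(g*) ≤ 3∕4`, `C(8g_IR³ + 16g_IR∕β*) ≤ (1 − θ)∕2`).  THEN
**`T4CauchySum.InjectedRate (2c∕(1 − θ)) 0 θ (fun K j ↦ disc (g K) (g (K + 1)) j)`** — node U2's `injectedRate_of_runs` with `BetaLowerH b γ β` and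
`C(γ³ + 2γ∕b) ≤ (1 − θ)∕2` DELETED in favour of the reference family and smallness of the renormalized coupling. [cite: Balaban1987RG1, (0.20) p.256, Thm 2 (0.31) p.259, §5 p.298] -/
theorem injectedRate_of_reference {γ θ C c bs gs gIR : ℝ} {Λ : ℕ → ℕ → ℝ} (g t : ℕ → ℕ → ℝ)
    (hθ0 : 0 < θ) (hθ1 : θ < 1) (hC : 0 ≤ C) (hc : 0 ≤ c) (hbs : 0 < bs)
    (hS : ScaleShiftRate c θ γ S.β) (hL : HistLipschitz Λ γ S.β) (hΛ : FadingMemory C θ Λ)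
    (hrun : ∀ K, RGEqH K S.β (g K)) (hbox : ∀ K i, i ≤ K → 0 < g K i ∧ g K i ≤ γ) (hpin : ∀ K, g K K = gIR)
    (hrunt : ∀ K, RGEqH K S.β (t K)) (hboxt : ∀ K i, i ≤ K → 0 < t K i ∧ t K i ≤ γ) (hpint : ∀ K, t K K = gs)
    (h031 : ∀ (K i : ℕ), i ≤ K → 1 / gs ^ 2 + bs * ((K : ℝ) - i) ≤ 1 / (t K i) ^ 2)
    (hs1 : 4 * C * gIR ≤ bs * (1 - θ))
    (hs2 : gIR ^ 2 * (C * γ / (1 - θ) ^ 2 + C / (1 - θ) * gs + (2 * C / ((1 - θ) * bs)) ^ 2 + 1 / (4 * gs ^ 2)) ≤ 3 / 4)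
    (hs3 : C * (8 * gIR ^ 3 + 16 * gIR / bs) ≤ (1 - θ) / 2) :
    InjectedRate (2 * c / (1 - θ)) 0 θ (fun K j => disc (g K) (g (K + 1)) j) := by
  intro K j hj
  refine ⟨disc_nonneg _ _ _, ?_⟩
  have h031K : ∀ K i, i ≤ K → 1 / (t K K) ^ 2 + bs * ((K : ℝ) - i) ≤ 1 / (t K i) ^ 2 := fun K i hi => by
    rw [hpint K]; exact h031 K i hi
  have hs1' : 4 * C * g K K ≤ bs * (1 - θ) := by rw [hpin K]; exact hs1
  have hs2A : (g K K) ^ 2 * (C * γ / (1 - θ) ^ 2 + C / (1 - θ) * t K K + (2 * C / ((1 - θ) * bs)) ^ 2 + 1 / (4 * (t K K) ^ 2))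
      ≤ 3 / 4 := by rw [hpin K, hpint K]; exact hs2
  have hs2B : (g K K) ^ 2 * (C * γ / (1 - θ) ^ 2 + C / (1 - θ) * t (K + 1) (K + 1) + (2 * C / ((1 - θ) * bs)) ^ 2
      + 1 / (4 * (t (K + 1) (K + 1)) ^ 2)) ≤ 3 / 4 := by rw [hpin K, hpint (K + 1)]; exact hs2
  have hs3' : C * (8 * (g K K) ^ 3 + 16 * g K K / bs) ≤ (1 - θ) / 2 := by rw [hpin K]; exact hs3
  have h := disc_le_of_reference hθ0 hθ1 hC hc hbs hS hL hΛ (hrun K) (hrun (K + 1)) (hrunt K) (hrunt (K + 1)) (hbox K) (hbox (K + 1))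
    (hboxt K) (hboxt (K + 1)) ((hpin K).trans (hpin (K + 1)).symm) (h031K K) (h031K (K + 1)) hs1' hs2A hs2B hs3' j hj
  simpa using h

/-- **ONE THRESHOLD FOR ALL PINNED FAMILIES.**  Under NE4, the moduli and ONE pinned reference family (rate β*, endpoint g*), there is e₀ > 0 (part 2's
`threshold_exists` e₀(C, θ, β*, g*, γ)) such that EVERY family of runs of (0.20) in ]0, γ] pinned at ANY renormalized coupling g_IR ≤ e₀ satisfies node
U2's `InjectedRate (2c∕(1 − θ)) 0 θ`. [cite: Balaban1987RG1, (0.20) p.256, Thm 2 (0.31) p.259, §5 p.298] -/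
theorem injectedRate_threshold_of_reference {γ θ C c bs gs : ℝ} {Λ : ℕ → ℕ → ℝ} (t : ℕ → ℕ → ℝ)
    (hθ0 : 0 < θ) (hθ1 : θ < 1) (hC : 0 ≤ C) (hc : 0 ≤ c) (hbs : 0 < bs)
    (hS : ScaleShiftRate c θ γ S.β) (hL : HistLipschitz Λ γ S.β) (hΛ : FadingMemory C θ Λ)
    (hrunt : ∀ K, RGEqH K S.β (t K)) (hboxt : ∀ K i, i ≤ K → 0 < t K i ∧ t K i ≤ γ) (hpint : ∀ K, t K K = gs)
    (h031 : ∀ (K i : ℕ), i ≤ K → 1 / gs ^ 2 + bs * ((K : ℝ) - i) ≤ 1 / (t K i) ^ 2) :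
    ∃ e₀ : ℝ, 0 < e₀ ∧ ∀ (g : ℕ → ℕ → ℝ) (gIR : ℝ), (∀ K, RGEqH K S.β (g K)) → (∀ K i, i ≤ K → 0 < g K i ∧ g K i ≤ γ) →
      (∀ K, g K K = gIR) → gIR ≤ e₀ → InjectedRate (2 * c / (1 - θ)) 0 θ (fun K j => disc (g K) (g (K + 1)) j) := by
  obtain ⟨e₀, he₀, hthr⟩ := threshold_exists (γ := γ) gs hθ1 hC hbs
  refine ⟨e₀, he₀, fun g gIR hrun hbox hpin hle => ?_⟩
  have hgIR : 0 < gIR := by rw [← hpin 0]; exact (hbox 0 0 le_rfl).1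
  obtain ⟨hs1, hs2, hs3⟩ := hthr gIR hgIR hle
  exact injectedRate_of_reference g t hθ0 hθ1 hC hc hbs hS hL hΛ hrun hbox hpin hrunt hboxt hpint h031 hs1 hs2 hs3

/-! ## §4 The continuum running coupling, read off node U2's `T4ContinuumCoupling` by name, with the contagion profiles in the limit -/

/-- ALONG THE FAMILY: the quarter-rate profile at every cutoff, read at a fixed physical scale m: `1∕(4g_IR²) + (β*∕4)·m ≤ invSq g m n = 1∕(g (n+m) n)²`
(part 2's `inv_sq_lower_of_reference` for the run with n + m steps against the reference run of the same depth). [cite: Balaban1987RG1, Thm 2 (0.31) p.259] -/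
theorem quarterProf_le_invSq {γ θ C bs gs gIR : ℝ} {Λ : ℕ → ℕ → ℝ} {g t : ℕ → ℕ → ℝ}
    (hθ0 : 0 ≤ θ) (hθ1 : θ < 1) (hC : 0 ≤ C) (hbs : 0 < bs)
    (hL : HistLipschitz Λ γ S.β) (hΛ : FadingMemory C θ Λ)
    (hrun : ∀ K, RGEqH K S.β (g K)) (hbox : ∀ K i, i ≤ K → 0 < g K i ∧ g K i ≤ γ) (hpin : ∀ K, g K K = gIR)
    (hrunt : ∀ K, RGEqH K S.β (t K)) (hboxt : ∀ K i, i ≤ K → 0 < t K i ∧ t K i ≤ γ) (hpint : ∀ K, t K K = gs)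
    (h031 : ∀ (K i : ℕ), i ≤ K → 1 / gs ^ 2 + bs * ((K : ℝ) - i) ≤ 1 / (t K i) ^ 2)
    (hs1 : 4 * C * gIR ≤ bs * (1 - θ))
    (hs2 : gIR ^ 2 * (C * γ / (1 - θ) ^ 2 + C / (1 - θ) * gs + (2 * C / ((1 - θ) * bs)) ^ 2 + 1 / (4 * gs ^ 2)) ≤ 3 / 4)
    (m n : ℕ) : 1 / (4 * gIR ^ 2) + bs / 4 * (m : ℝ) ≤ invSq g m n := by
  have h031K : ∀ i, i ≤ n + m → 1 / (t (n + m) (n + m)) ^ 2 + bs * (((n + m : ℕ) : ℝ) - i) ≤ 1 / (t (n + m) i) ^ 2 :=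
    fun i hi => by rw [hpint (n + m)]; exact h031 (n + m) i hi
  have hs1' : 4 * C * g (n + m) (n + m) ≤ bs * (1 - θ) := by rw [hpin (n + m)]; exact hs1
  have hs2' : (g (n + m) (n + m)) ^ 2 * (C * γ / (1 - θ) ^ 2 + C / (1 - θ) * t (n + m) (n + m) + (2 * C / ((1 - θ) * bs)) ^ 2
      + 1 / (4 * (t (n + m) (n + m)) ^ 2)) ≤ 3 / 4 := by rw [hpin (n + m), hpint (n + m)]; exact hs2
  have h := inv_sq_lower_of_reference hθ0 hθ1 hC hbs hL hΛ (hrun (n + m)) (hrunt (n + m)) (hbox (n + m)) (hboxt (n + m)) h031K hs1' hs2'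
    n (Nat.le_add_right n m)
  rw [hpin (n + m)] at h
  have e1 : (((n + m : ℕ) : ℝ) - n) = (m : ℝ) := by push_cast; ring
  rw [e1] at h
  simpa [T4ContinuumCoupling.invSq] using h

/-- **IN THE LIMIT: `1∕(4g_IR²) + (β*∕4)·m ≤ astar g m`** — the contagion's quarter-rate profile passes to the continuum recursion variable at every
physical scale (node U2's `tendsto_invSq` under `InjectedRate`, `ge_of_tendsto`). [cite: Balaban1987RG1, Thm 2 (0.31) p.259] -/
theorem quarterProf_le_astar {γ θ C c' ρ bs gs gIR : ℝ} {Λ : ℕ → ℕ → ℝ} {g t : ℕ → ℕ → ℝ}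
    (hρ1 : ρ < 1) (hinj : InjectedRate c' 0 ρ (fun K j => disc (g K) (g (K + 1)) j))
    (hθ0 : 0 ≤ θ) (hθ1 : θ < 1) (hC : 0 ≤ C) (hbs : 0 < bs)
    (hL : HistLipschitz Λ γ S.β) (hΛ : FadingMemory C θ Λ)
    (hrun : ∀ K, RGEqH K S.β (g K)) (hbox : ∀ K i, i ≤ K → 0 < g K i ∧ g K i ≤ γ) (hpin : ∀ K, g K K = gIR)
    (hrunt : ∀ K, RGEqH K S.β (t K)) (hboxt : ∀ K i, i ≤ K → 0 < t K i ∧ t K i ≤ γ) (hpint : ∀ K, t K K = gs)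
    (h031 : ∀ (K i : ℕ), i ≤ K → 1 / gs ^ 2 + bs * ((K : ℝ) - i) ≤ 1 / (t K i) ^ 2)
    (hs1 : 4 * C * gIR ≤ bs * (1 - θ))
    (hs2 : gIR ^ 2 * (C * γ / (1 - θ) ^ 2 + C / (1 - θ) * gs + (2 * C / ((1 - θ) * bs)) ^ 2 + 1 / (4 * gs ^ 2)) ≤ 3 / 4)
    (m : ℕ) : 1 / (4 * gIR ^ 2) + bs / 4 * (m : ℝ) ≤ astar g m :=
  ge_of_tendsto (tendsto_invSq hρ1 hinj m)
    (Eventually.of_forall fun n => quarterProf_le_invSq hθ0 hθ1 hC hbs hL hΛ hrun hbox hpin hrunt hboxt hpint h031 hs1 hs2 m n)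

/-- **LOGARITHMIC ASYMPTOTIC FREEDOM OF THE CONTINUUM RUNNING COUPLING, WITH NO ASYMPTOTIC-FREEDOM LETTER ON β**: under the data of `quarterProf_le_astar`,
`gstar g m ≤ 1∕sprof (2g_IR) (β*∕4) m = (1∕(4g_IR²) + (β*∕4)·m)^{−1∕2}` at every physical scale m — node U2's `gstar_le_inv_sprof` had this from
`EventualLowerH b γ k₀ β` at base point g_IR and rate b; here base point 2g_IR and rate β*∕4 from ONE reference family. [cite: Balaban1987RG1, Thm 2 (0.31) p.259] -/
theorem gstar_le_of_reference {γ θ C c' ρ bs gs gIR : ℝ} {Λ : ℕ → ℕ → ℝ} {g t : ℕ → ℕ → ℝ}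
    (hρ1 : ρ < 1) (hinj : InjectedRate c' 0 ρ (fun K j => disc (g K) (g (K + 1)) j))
    (hθ0 : 0 ≤ θ) (hθ1 : θ < 1) (hC : 0 ≤ C) (hbs : 0 < bs)
    (hL : HistLipschitz Λ γ S.β) (hΛ : FadingMemory C θ Λ)
    (hrun : ∀ K, RGEqH K S.β (g K)) (hbox : ∀ K i, i ≤ K → 0 < g K i ∧ g K i ≤ γ) (hpin : ∀ K, g K K = gIR)
    (hrunt : ∀ K, RGEqH K S.β (t K)) (hboxt : ∀ K i, i ≤ K → 0 < t K i ∧ t K i ≤ γ) (hpint : ∀ K, t K K = gs)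
    (h031 : ∀ (K i : ℕ), i ≤ K → 1 / gs ^ 2 + bs * ((K : ℝ) - i) ≤ 1 / (t K i) ^ 2)
    (hs1 : 4 * C * gIR ≤ bs * (1 - θ))
    (hs2 : gIR ^ 2 * (C * γ / (1 - θ) ^ 2 + C / (1 - θ) * gs + (2 * C / ((1 - θ) * bs)) ^ 2 + 1 / (4 * gs ^ 2)) ≤ 3 / 4)
    (m : ℕ) : gstar g m ≤ 1 / sprof (2 * gIR) (bs / 4) m := by
  have hgIR : 0 < gIR := by rw [← hpin 0]; exact (hbox 0 0 le_rfl).1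
  have h2g : 0 < 2 * gIR := by positivity
  have hb4 : 0 ≤ bs / 4 := by positivity
  have h := quarterProf_le_astar hρ1 hinj hθ0 hθ1 hC hbs hL hΛ hrun hbox hpin hrunt hboxt hpint h031 hs1 hs2 m
  have hprof : prof (2 * gIR) (bs / 4) m = 1 / (4 * gIR ^ 2) + bs / 4 * (m : ℝ) := by
    unfold T4CouplingMatching.prof
    ring
  unfold T4ContinuumCoupling.gstar T4CouplingMatching.sprof
  rw [hprof]
  exact one_div_le_one_div_of_le (Real.sqrt_pos.mpr (by rw [← hprof]; exact prof_pos h2g hb4 m)) (Real.sqrt_le_sqrt h)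

/-- **THE UPPER HALF IN THE LIMIT.**  If the reference family also carries (0.31)'s upper half from g* at rate β′*, then along the family
`invSq g m n ≤ 7∕(4g_IR²) + (β′* + 3β*∕4)·m` (part 2's `inv_sq_upper_of_reference`) and in the limit **`astar g m ≤ 7∕(4g_IR²) + (β′* + 3β*∕4)·m`**: with
`quarterProf_le_astar`, the continuum recursion variable obeys the printed TWO-SIDED logarithmic running (0.31) at every physical scale, with ONE pair of
constants and an end-anchored defect — no (U) letter, no AF letter. [cite: Balaban1987RG1, Thm 2 (0.31) p.259] -/
theorem astar_le_of_reference_upper {γ θ C c' ρ bs bs' gs gIR : ℝ} {Λ : ℕ → ℕ → ℝ} {g t : ℕ → ℕ → ℝ}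
    (hρ1 : ρ < 1) (hinj : InjectedRate c' 0 ρ (fun K j => disc (g K) (g (K + 1)) j))
    (hθ0 : 0 ≤ θ) (hθ1 : θ < 1) (hC : 0 ≤ C) (hbs : 0 < bs)
    (hL : HistLipschitz Λ γ S.β) (hΛ : FadingMemory C θ Λ)
    (hrun : ∀ K, RGEqH K S.β (g K)) (hbox : ∀ K i, i ≤ K → 0 < g K i ∧ g K i ≤ γ) (hpin : ∀ K, g K K = gIR)
    (hrunt : ∀ K, RGEqH K S.β (t K)) (hboxt : ∀ K i, i ≤ K → 0 < t K i ∧ t K i ≤ γ) (hpint : ∀ K, t K K = gs)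
    (h031 : ∀ (K i : ℕ), i ≤ K → 1 / gs ^ 2 + bs * ((K : ℝ) - i) ≤ 1 / (t K i) ^ 2)
    (h031' : ∀ (K i : ℕ), i ≤ K → 1 / (t K i) ^ 2 ≤ 1 / gs ^ 2 + bs' * ((K : ℝ) - i))
    (hs1 : 4 * C * gIR ≤ bs * (1 - θ))
    (hs2 : gIR ^ 2 * (C * γ / (1 - θ) ^ 2 + C / (1 - θ) * gs + (2 * C / ((1 - θ) * bs)) ^ 2 + 1 / (4 * gs ^ 2)) ≤ 3 / 4)
    (m : ℕ) : astar g m ≤ 7 / (4 * gIR ^ 2) + (bs' + 3 * bs / 4) * (m : ℝ) := by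
  refine le_of_tendsto (tendsto_invSq hρ1 hinj m) (Eventually.of_forall fun n => ?_)
  have h031K : ∀ i, i ≤ n + m → 1 / (t (n + m) (n + m)) ^ 2 + bs * (((n + m : ℕ) : ℝ) - i) ≤ 1 / (t (n + m) i) ^ 2 :=
    fun i hi => by rw [hpint (n + m)]; exact h031 (n + m) i hi
  have h031K' : ∀ i, i ≤ n + m → 1 / (t (n + m) i) ^ 2 ≤ 1 / (t (n + m) (n + m)) ^ 2 + bs' * (((n + m : ℕ) : ℝ) - i) :=
    fun i hi => by rw [hpint (n + m)]; exact h031' (n + m) i hi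
  have hs1' : 4 * C * g (n + m) (n + m) ≤ bs * (1 - θ) := by rw [hpin (n + m)]; exact hs1
  have hs2' : (g (n + m) (n + m)) ^ 2 * (C * γ / (1 - θ) ^ 2 + C / (1 - θ) * t (n + m) (n + m) + (2 * C / ((1 - θ) * bs)) ^ 2
      + 1 / (4 * (t (n + m) (n + m)) ^ 2)) ≤ 3 / 4 := by rw [hpin (n + m), hpint (n + m)]; exact hs2
  have h := inv_sq_upper_of_reference hθ0 hθ1 hC hbs hL hΛ (hrun (n + m)) (hrunt (n + m)) (hbox (n + m)) (hboxt (n + m)) h031K h031K'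
    hs1' hs2' n (Nat.le_add_right n m)
  rw [hpin (n + m)] at h
  have e1 : (((n + m : ℕ) : ℝ) - n) = (m : ℝ) := by push_cast; ring
  rw [e1] at h
  simpa [T4ContinuumCoupling.invSq] using h

/-- The continuum recursion variable telescopes over the physical scales: `astar g m = astar g 0 + Σ_{i<m} bstar g i` (node U2's `astar_succ`). [folklore] -/
theorem astar_eq_add_sum_bstar (g : ℕ → ℕ → ℝ) (m : ℕ) : astar g m = astar g 0 + ∑ i ∈ range m, bstar g i := by
  induction m with
  | zero => simp
  | succ m ih => rw [T4ContinuumCoupling.astar_succ, ih, Finset.sum_range_succ]; ring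

/-- **THE CONTINUUM β-VALUES ARE ASYMPTOTICALLY FREE ON AVERAGE, WITH AN END DEFECT** — what replaces node U2's pointwise floor
`ContinuumRunning.lower` here: under the data of `quarterProf_le_astar`, **`(β*∕4)·m − 3∕(4g_IR²) ≤ Σ_{i<m} bstar g i`** for every m, i.e. the Cesàro means of
the continuum β-values over the first m physical scales are `≥ β*∕4 − 3∕(4g_IR²m)` (`astar g 0 = 1∕g_IR²` by the pin).  A POINTWISE floor is not claimed
(part 3: the end-anchored defect is genuine). [cite: Balaban1987RG1, Thm 2 (0.31) p.259] -/
theorem sum_bstar_lower_of_reference {γ θ C c' ρ bs gs gIR : ℝ} {Λ : ℕ → ℕ → ℝ} {g t : ℕ → ℕ → ℝ}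
    (hρ1 : ρ < 1) (hinj : InjectedRate c' 0 ρ (fun K j => disc (g K) (g (K + 1)) j))
    (hθ0 : 0 ≤ θ) (hθ1 : θ < 1) (hC : 0 ≤ C) (hbs : 0 < bs)
    (hL : HistLipschitz Λ γ S.β) (hΛ : FadingMemory C θ Λ)
    (hrun : ∀ K, RGEqH K S.β (g K)) (hbox : ∀ K i, i ≤ K → 0 < g K i ∧ g K i ≤ γ) (hpin : ∀ K, g K K = gIR)
    (hrunt : ∀ K, RGEqH K S.β (t K)) (hboxt : ∀ K i, i ≤ K → 0 < t K i ∧ t K i ≤ γ) (hpint : ∀ K, t K K = gs)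
    (h031 : ∀ (K i : ℕ), i ≤ K → 1 / gs ^ 2 + bs * ((K : ℝ) - i) ≤ 1 / (t K i) ^ 2)
    (hs1 : 4 * C * gIR ≤ bs * (1 - θ))
    (hs2 : gIR ^ 2 * (C * γ / (1 - θ) ^ 2 + C / (1 - θ) * gs + (2 * C / ((1 - θ) * bs)) ^ 2 + 1 / (4 * gs ^ 2)) ≤ 3 / 4)
    (m : ℕ) : bs / 4 * (m : ℝ) - 3 / (4 * gIR ^ 2) ≤ ∑ i ∈ range m, bstar g i := by
  have hgIR : 0 < gIR := by rw [← hpin 0]; exact (hbox 0 0 le_rfl).1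
  have h := quarterProf_le_astar hρ1 hinj hθ0 hθ1 hC hbs hL hΛ hrun hbox hpin hrunt hboxt hpint h031 hs1 hs2 m
  rw [astar_eq_add_sum_bstar g m, T4ContinuumCoupling.astar_zero hρ1 hinj hpin] at h
  have e : 1 / (4 * gIR ^ 2) = 1 / gIR ^ 2 - 3 / (4 * gIR ^ 2) := by
    field_simp
    ring
  linarith

/-- … and from above, if the reference family carries (0.31)'s upper half: **`Σ_{i<m} bstar g i ≤ 3∕(4g_IR²) + (β′* + 3β*∕4)·m`**. [cite: Balaban1987RG1, Thm 2 (0.31) p.259] -/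
theorem sum_bstar_upper_of_reference_upper {γ θ C c' ρ bs bs' gs gIR : ℝ} {Λ : ℕ → ℕ → ℝ} {g t : ℕ → ℕ → ℝ}
    (hρ1 : ρ < 1) (hinj : InjectedRate c' 0 ρ (fun K j => disc (g K) (g (K + 1)) j))
    (hθ0 : 0 ≤ θ) (hθ1 : θ < 1) (hC : 0 ≤ C) (hbs : 0 < bs)
    (hL : HistLipschitz Λ γ S.β) (hΛ : FadingMemory C θ Λ)
    (hrun : ∀ K, RGEqH K S.β (g K)) (hbox : ∀ K i, i ≤ K → 0 < g K i ∧ g K i ≤ γ) (hpin : ∀ K, g K K = gIR)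
    (hrunt : ∀ K, RGEqH K S.β (t K)) (hboxt : ∀ K i, i ≤ K → 0 < t K i ∧ t K i ≤ γ) (hpint : ∀ K, t K K = gs)
    (h031 : ∀ (K i : ℕ), i ≤ K → 1 / gs ^ 2 + bs * ((K : ℝ) - i) ≤ 1 / (t K i) ^ 2)
    (h031' : ∀ (K i : ℕ), i ≤ K → 1 / (t K i) ^ 2 ≤ 1 / gs ^ 2 + bs' * ((K : ℝ) - i))
    (hs1 : 4 * C * gIR ≤ bs * (1 - θ))
    (hs2 : gIR ^ 2 * (C * γ / (1 - θ) ^ 2 + C / (1 - θ) * gs + (2 * C / ((1 - θ) * bs)) ^ 2 + 1 / (4 * gs ^ 2)) ≤ 3 / 4)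
    (m : ℕ) : ∑ i ∈ range m, bstar g i ≤ 3 / (4 * gIR ^ 2) + (bs' + 3 * bs / 4) * (m : ℝ) := by
  have hgIR : 0 < gIR := by rw [← hpin 0]; exact (hbox 0 0 le_rfl).1
  have h := astar_le_of_reference_upper hρ1 hinj hθ0 hθ1 hC hbs hL hΛ hrun hbox hpin hrunt hboxt hpint h031 h031' hs1 hs2 m
  rw [astar_eq_add_sum_bstar g m, T4ContinuumCoupling.astar_zero hρ1 hinj hpin] at h
  have e : 7 / (4 * gIR ^ 2) = 1 / gIR ^ 2 + 3 / (4 * gIR ^ 2) := by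
    field_simp
    ring
  linarith

/-- **THE CONTINUUM RUNNING COUPLING FROM ONE REFERENCE FAMILY — the package.**  Under the data of `injectedRate_of_reference` (NE4, the moduli with
fading memory, the pinned family of runs of (0.20) in ]0, γ], the pinned reference family with (0.31)'s lower half, and the renormalized coupling g_IR
below the three thresholds): at EVERY physical scale m the effective couplings converge as the cutoff is removed, `g (n+m) n → gstar g m ∈ ]0, γ]`,
with `gstar g 0 = g_IR` (the renormalization condition survives), the LIMIT FLOW `1∕(gstar g (m+1))² = 1∕(gstar g m)² + bstar g m` with the diagonal
β-values converging to `bstar g m`, the GEOMETRIC TAIL `|1∕(g (n+m) n)² − 1∕(gstar g m)²| ≤ (2c∕(1 − θ))θ^n∕(1 − θ)`, and LOGARITHMIC ASYMPTOTIC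
FREEDOM `gstar g m ≤ (1∕(4g_IR²) + (β*∕4)m)^{−1∕2}` — node U2's `T4ContinuumCoupling` read-out BY NAME on §3's `InjectedRate` plus §4's limit
profile; `ContinuumRunning` minus its pointwise floor `lower`, with `af` at base 2g_IR and rate β*∕4.  NO asymptotic-freedom letter, NO sign, NO
box admission condition. [cite: Balaban1987RG1, (0.20) p.256, Thm 2 (0.31) p.259, §5 p.298] -/
theorem continuumCoupling_of_reference {γ θ C c bs gs gIR : ℝ} {Λ : ℕ → ℕ → ℝ} (g t : ℕ → ℕ → ℝ)
    (hθ0 : 0 < θ) (hθ1 : θ < 1) (hC : 0 ≤ C) (hc : 0 ≤ c) (hbs : 0 < bs)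
    (hS : ScaleShiftRate c θ γ S.β) (hL : HistLipschitz Λ γ S.β) (hΛ : FadingMemory C θ Λ)
    (hrun : ∀ K, RGEqH K S.β (g K)) (hbox : ∀ K i, i ≤ K → 0 < g K i ∧ g K i ≤ γ) (hpin : ∀ K, g K K = gIR)
    (hrunt : ∀ K, RGEqH K S.β (t K)) (hboxt : ∀ K i, i ≤ K → 0 < t K i ∧ t K i ≤ γ) (hpint : ∀ K, t K K = gs)
    (h031 : ∀ (K i : ℕ), i ≤ K → 1 / gs ^ 2 + bs * ((K : ℝ) - i) ≤ 1 / (t K i) ^ 2)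
    (hs1 : 4 * C * gIR ≤ bs * (1 - θ))
    (hs2 : gIR ^ 2 * (C * γ / (1 - θ) ^ 2 + C / (1 - θ) * gs + (2 * C / ((1 - θ) * bs)) ^ 2 + 1 / (4 * gs ^ 2)) ≤ 3 / 4)
    (hs3 : C * (8 * gIR ^ 3 + 16 * gIR / bs) ≤ (1 - θ) / 2) :
    (∀ m, Tendsto (fun n => g (n + m) n) atTop (𝓝 (gstar g m))) ∧ (∀ m, 0 < gstar g m ∧ gstar g m ≤ γ) ∧ gstar g 0 = gIR ∧
      (∀ m, 1 / (gstar g (m + 1)) ^ 2 = 1 / (gstar g m) ^ 2 + bstar g m) ∧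
      (∀ m, Tendsto (fun n => S.β n (prefixOf (g (n + m + 1)) n)) atTop (𝓝 (bstar g m))) ∧
      (∀ m n, |1 / (g (n + m) n) ^ 2 - 1 / (gstar g m) ^ 2| ≤ 2 * c / (1 - θ) * θ ^ n / (1 - θ)) ∧
      (∀ m, gstar g m ≤ 1 / sprof (2 * gIR) (bs / 4) m) := by
  have hinj := injectedRate_of_reference g t hθ0 hθ1 hC hc hbs hS hL hΛ hrun hbox hpin hrunt hboxt hpint h031 hs1 hs2 hs3
  refine ⟨tendsto_coupling hθ1 hinj hbox, fun m => ⟨gstar_pos hθ1 hinj hbox m, gstar_le hθ1 hinj hbox m⟩, gstar_zero hθ1 hinj hbox hpin,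
    gstar_flow hθ1 hinj hbox, tendsto_beta_diag hθ1 hinj hrun, fun m n => ?_,
    gstar_le_of_reference hθ1 hinj hθ0.le hθ1 hC hbs hL hΛ hrun hbox hpin hrunt hboxt hpint h031 hs1 hs2⟩
  rw [one_div_gstar_sq hθ1 hinj hbox m, ← T4ContinuumCoupling.invSq_def]
  exact abs_invSq_sub_astar_le hθ1 hinj m n

/-- **ONE THRESHOLD, EVERY RENORMALIZED COUPLING BELOW IT: THE CONTINUUM RUNNING COUPLING OF EVERY PINNED FAMILY.**  Under NE4, the moduli with fading
memory and ONE pinned reference family with (0.31)'s lower half (rate β*, endpoint g*), there is e₀ > 0 such that EVERY family of runs of (0.20) in ]0, γ]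
pinned at ANY g_IR ≤ e₀ has a continuum running coupling at every physical scale (convergence, `gstar 0 = g_IR`, limit flow, geometric tail with node
U2's constant 2c∕(1 − θ) and rate θ, log-AF bound at base 2g_IR and rate β*∕4). [cite: Balaban1987RG1, (0.20) p.256, Thm 2 (0.31) p.259, §5 p.298] -/
theorem continuumCoupling_threshold_of_reference {γ θ C c bs gs : ℝ} {Λ : ℕ → ℕ → ℝ} (t : ℕ → ℕ → ℝ)
    (hθ0 : 0 < θ) (hθ1 : θ < 1) (hC : 0 ≤ C) (hc : 0 ≤ c) (hbs : 0 < bs)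
    (hS : ScaleShiftRate c θ γ S.β) (hL : HistLipschitz Λ γ S.β) (hΛ : FadingMemory C θ Λ)
    (hrunt : ∀ K, RGEqH K S.β (t K)) (hboxt : ∀ K i, i ≤ K → 0 < t K i ∧ t K i ≤ γ) (hpint : ∀ K, t K K = gs)
    (h031 : ∀ (K i : ℕ), i ≤ K → 1 / gs ^ 2 + bs * ((K : ℝ) - i) ≤ 1 / (t K i) ^ 2) :
    ∃ e₀ : ℝ, 0 < e₀ ∧ ∀ (g : ℕ → ℕ → ℝ) (gIR : ℝ), (∀ K, RGEqH K S.β (g K)) → (∀ K i, i ≤ K → 0 < g K i ∧ g K i ≤ γ) →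
      (∀ K, g K K = gIR) → gIR ≤ e₀ →
      InjectedRate (2 * c / (1 - θ)) 0 θ (fun K j => disc (g K) (g (K + 1)) j) ∧
      (∀ m, Tendsto (fun n => g (n + m) n) atTop (𝓝 (gstar g m))) ∧ (∀ m, 0 < gstar g m ∧ gstar g m ≤ γ) ∧ gstar g 0 = gIR ∧
      (∀ m, 1 / (gstar g (m + 1)) ^ 2 = 1 / (gstar g m) ^ 2 + bstar g m) ∧
      (∀ m, Tendsto (fun n => S.β n (prefixOf (g (n + m + 1)) n)) atTop (𝓝 (bstar g m))) ∧
      (∀ m n, |1 / (g (n + m) n) ^ 2 - 1 / (gstar g m) ^ 2| ≤ 2 * c / (1 - θ) * θ ^ n / (1 - θ)) ∧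
      (∀ m, gstar g m ≤ 1 / sprof (2 * gIR) (bs / 4) m) := by
  obtain ⟨e₀, he₀, hthr⟩ := threshold_exists (γ := γ) gs hθ1 hC hbs
  refine ⟨e₀, he₀, fun g gIR hrun hbox hpin hle => ?_⟩
  have hgIR : 0 < gIR := by rw [← hpin 0]; exact (hbox 0 0 le_rfl).1
  obtain ⟨hs1, hs2, hs3⟩ := hthr gIR hgIR hle
  exact ⟨injectedRate_of_reference g t hθ0 hθ1 hC hc hbs hS hL hΛ hrun hbox hpin hrunt hboxt hpint h031 hs1 hs2 hs3,
    continuumCoupling_of_reference g t hθ0 hθ1 hC hc hbs hS hL hΛ hrun hbox hpin hrunt hboxt hpint h031 hs1 hs2 hs3⟩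

end

end Summit.QuantumFields.BalabanUV.Beta.EriceFlowEnclosureB12AsPrintedHistoryContagionShift
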